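import Summits.NavierStokesRegularity.NavierStokesRegularity.Theorems.ExtremiserTransienceBangBangCoreDefs
import Summits.NavierStokesRegularity.NavierStokesRegularity.Theorems.ExtremiserTransienceKStarAttainedPerturbation
import Literature.Analysis.FluidPDE.AlexakisDoeringInterpolation
import HarnessLib

/-!
# Route `ExtremiserTransience`, crux `RegularisedNearPlateauStability` (stmt-NavierStokesRegularity-28317),
# LINE g8-α «sparse bang-bang»: HÖLDER BOUNDS FOR THE VARIATION COEFFICIENTS

`--supports stmt-NavierStokesRegularity-28317` (helper). Author: prover seat `ns-net-p2` (g2).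

The sizes of the coefficients of the shrinking sextic (`…SparseBangBangSlackVariation.abs_ell_add_le_of_shrinking`)
are controlled WITHOUT integration by parts, by `L∞ · L² · L²` Hölder: for a field `v` with `‖Dv‖ ≤ L_v`, `curl v ∈ L²`,
and a test direction `φ ∈ C_c^∞` with `‖Dφ‖ ≤ L_φ`,
* `abs_integral_inner_clm_le` — `|∫⟪a, T c⟫| ≤ L·‖a‖₂·‖c‖₂` when `‖T‖ ≤ L` pointwise (`a, c` continuous, square integrable);
* `abs_A1_le` — `|a₁(φ)| = |∫⟪curl v, curl φ⟫| ≤ √Z(v)·√Z(φ)`;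
* `abs_C1_le` — `|c₁(φ)| = |∫Σᵢ⟪∂ᵢcurl v, ∂ᵢcurl φ⟫| ≤ √W(v)·√W(φ)`;
* `abs_J1_le` — `|J₁(v;φ)| ≤ 2L_v·√Z(v)·√Z(φ) + L_φ·Z(v)`, and symmetrically `abs_J1_swap_le` for `J₁(φ;v)`;
* `abs_Jst_le` — `|J(φ)| ≤ L_φ·Z(φ)`.
In the sparse bang-bang assembly `L_v = A₁M/λ`, `L_φ = ΛM/λ` and `Z = λ²W` turn these into multiples of `U = M√Z√W`.
HONEST FRAMING: Cauchy–Schwarz bookkeeping; nothing about Navier–Stokes is proved; no summit is proved by a line. [folklore]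
-/

noncomputable section

open MeasureTheory Set Filter
open scoped InnerProductSpace RealInnerProductSpace ENNReal ContDiff
open Literature.Analysis.FluidPDE
open Summit.NavierStokesRegularity.NavierStokesRegularity.Theorems.DepletionLadder.KStar.HalfSpace

namespace Summit.NavierStokesRegularity.NavierStokesRegularity.Theorems

-- the problem directory repeats the summit name (`NavierStokesRegularity/NavierStokesRegularity`)
set_option linter.dupNamespace false

namespace DepletionLadder.KStar.BangBang

open Summit.NavierStokesRegularity.NavierStokesRegularity.Theorems.RungReynoldsOne.WeightedSlice
  (integrable_of_norm_le_const_mul_mul)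

variable {v φ : E3 → E3}

/-! ## 1. `L∞ · L² · L²` Hölder -/

/-- **`L²` Cauchy–Schwarz for vector fields**: `∫‖a‖‖c‖ ≤ √(∫‖a‖²)·√(∫‖c‖²)` for continuous square-integrable
fields. [folklore] -/
theorem integral_norm_mul_norm_le {a c : E3 → E3} (ha : Continuous a) (hc : Continuous c)
    (ha2 : ∫⁻ x, ‖a x‖ₑ ^ 2 < ⊤) (hc2 : ∫⁻ x, ‖c x‖ₑ ^ 2 < ⊤) :
    ∫ x, ‖a x‖ * ‖c x‖ ≤ Real.sqrt (∫ x, ‖a x‖ ^ 2) * Real.sqrt (∫ x, ‖c x‖ ^ 2) := by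
  have hia : Integrable (fun x => ‖a x‖ ^ 2) := integrable_sq_norm_of_lintegral_lt_top ha ha2
  have hic : Integrable (fun x => ‖c x‖ ^ 2) := integrable_sq_norm_of_lintegral_lt_top hc hc2
  have h := Literature.Analysis.FluidPDE.integral_le_sqrt_integral_mul_integral
    (μ := (volume : Measure E3)) (G := fun x => ‖a x‖ * ‖c x‖) (E := fun x => ‖a x‖ ^ 2) (L := fun x => ‖c x‖ ^ 2)
    (Eventually.of_forall fun x => mul_nonneg (norm_nonneg _) (norm_nonneg _))
    (Eventually.of_forall fun x => sq_nonneg _) (Eventually.of_forall fun x => sq_nonneg _)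
    (Eventually.of_forall fun x => by simp only [mul_pow]; exact le_rfl)
    ((ha.norm.mul hc.norm).aestronglyMeasurable) hia hic
  rwa [Real.sqrt_mul (integral_nonneg fun x => sq_nonneg _)] at h

/-- **`L∞ · L² · L²` Hölder.** If `‖T x‖ ≤ L` for all `x` (`T` any field of linear maps) and `a, c` are
continuous square-integrable fields, then `|∫⟪a, T c⟫| ≤ L·√(∫‖a‖²)·√(∫‖c‖²)`. [folklore] -/
theorem abs_integral_inner_clm_le {a c : E3 → E3} {T : E3 → (E3 →L[ℝ] E3)} {L : ℝ} (ha : Continuous a)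
    (hc : Continuous c) (hL : ∀ x, ‖T x‖ ≤ L)
    (ha2 : ∫⁻ x, ‖a x‖ₑ ^ 2 < ⊤) (hc2 : ∫⁻ x, ‖c x‖ₑ ^ 2 < ⊤) :
    |∫ x, ⟪a x, T x (c x)⟫_ℝ| ≤ L * Real.sqrt (∫ x, ‖a x‖ ^ 2) * Real.sqrt (∫ x, ‖c x‖ ^ 2) := by
  have hL0 : 0 ≤ L := (norm_nonneg _).trans (hL 0)
  have hprod : Integrable (fun x => ‖a x‖ * ‖c x‖) :=
    integrable_of_norm_le_const_mul_mul 1 (ha.norm.mul hc.norm) ha hc ha2 hc2 fun x => by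
      rw [Real.norm_of_nonneg (mul_nonneg (norm_nonneg _) (norm_nonneg _)), one_mul]
  have hpt : ∀ x, |⟪a x, T x (c x)⟫_ℝ| ≤ L * (‖a x‖ * ‖c x‖) := fun x => by
    calc |⟪a x, T x (c x)⟫_ℝ| ≤ ‖a x‖ * ‖T x (c x)‖ := abs_real_inner_le_norm _ _
      _ ≤ ‖a x‖ * (L * ‖c x‖) :=
          mul_le_mul_of_nonneg_left ((T x).le_of_opNorm_le (hL x) _) (norm_nonneg _)
      _ = L * (‖a x‖ * ‖c x‖) := by ring
  calc |∫ x, ⟪a x, T x (c x)⟫_ℝ| ≤ ∫ x, |⟪a x, T x (c x)⟫_ℝ| := abs_integral_le_integral_abs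
    _ ≤ ∫ x, L * (‖a x‖ * ‖c x‖) :=
        integral_mono_of_nonneg (Eventually.of_forall fun x => abs_nonneg _) (hprod.const_mul L)
          (Eventually.of_forall hpt)
    _ = L * ∫ x, ‖a x‖ * ‖c x‖ := integral_const_mul _ _
    _ ≤ L * (Real.sqrt (∫ x, ‖a x‖ ^ 2) * Real.sqrt (∫ x, ‖c x‖ ^ 2)) :=
        mul_le_mul_of_nonneg_left (integral_norm_mul_norm_le ha hc ha2 hc2) hL0
    _ = L * Real.sqrt (∫ x, ‖a x‖ ^ 2) * Real.sqrt (∫ x, ‖c x‖ ^ 2) := by ring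

/-! ## 2. The coefficients `a₁, c₁` -/

/-- `curl φ ∈ L²` for `φ ∈ C_c^∞`. [folklore] -/
theorem lintegral_enorm_curl_sq_lt_top_of_hasCompactSupport (hφ : ContDiff ℝ ∞ φ) (hφc : HasCompactSupport φ) :
    ∫⁻ x, ‖curl φ x‖ₑ ^ 2 < ⊤ :=
  lintegral_enorm_sq_lt_top_of_integrable_sq (continuous_curl (hφ.of_le (by norm_cast))).aestronglyMeasurable
    (integrable_enstrophy_coeffs hφ hφ hφc).2

/-- **`|a₁(φ)| ≤ √Z(v)·√Z(φ)`.** [folklore] -/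
theorem abs_A1_le (hv : ContDiff ℝ ∞ v) (h1 : ∫⁻ x, ‖iteratedFDeriv ℝ 1 v x‖ₑ ^ 2 < ⊤) (hφ : ContDiff ℝ ∞ φ)
    (hφc : HasCompactSupport φ) : |A1 v φ| ≤ Real.sqrt (Zen v) * Real.sqrt (Zen φ) := by
  have cω : Continuous (curl v) := continuous_curl (hv.of_le (by norm_cast))
  have cψ : Continuous (curl φ) := continuous_curl (hφ.of_le (by norm_cast))
  have h := abs_integral_inner_clm_le (T := fun _ => ContinuousLinearMap.id ℝ E3) (L := ‖ContinuousLinearMap.id ℝ E3‖)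
    cω cψ (fun _ => le_rfl) (lintegral_enorm_curl_sq_lt_top hv h1)
    (lintegral_enorm_curl_sq_lt_top_of_hasCompactSupport hφ hφc)
  simp only [ContinuousLinearMap.id_apply] at h
  refine h.trans ?_
  have h1' : ‖ContinuousLinearMap.id ℝ E3‖ ≤ 1 := ContinuousLinearMap.norm_id_le
  have hnn : 0 ≤ Real.sqrt (Zen v) * Real.sqrt (Zen φ) := mul_nonneg (Real.sqrt_nonneg _) (Real.sqrt_nonneg _)
  calc ‖ContinuousLinearMap.id ℝ E3‖ * Real.sqrt (∫ x, ‖curl v x‖ ^ 2) * Real.sqrt (∫ x, ‖curl φ x‖ ^ 2)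
      = ‖ContinuousLinearMap.id ℝ E3‖ * (Real.sqrt (Zen v) * Real.sqrt (Zen φ)) := by simp only [Zen]; ring
    _ ≤ 1 * (Real.sqrt (Zen v) * Real.sqrt (Zen φ)) := mul_le_mul_of_nonneg_right h1' hnn
    _ = Real.sqrt (Zen v) * Real.sqrt (Zen φ) := one_mul _

/-- Finite-dimensional Cauchy–Schwarz for the Frobenius pairing: `|Σᵢ⟪A eᵢ, B eᵢ⟫| ≤ √|A|²_F · √|B|²_F`. [folklore] -/
theorem abs_sum_inner_apply_le (A B : E3 →L[ℝ] E3) :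
    |∑ i, ⟪A (EuclideanSpace.basisFun (Fin 3) ℝ i), B (EuclideanSpace.basisFun (Fin 3) ℝ i)⟫_ℝ| ≤
      Real.sqrt (frobeniusNormSq A) * Real.sqrt (frobeniusNormSq B) := by
  set e := EuclideanSpace.basisFun (Fin 3) ℝ
  have h1 : |∑ i, ⟪A (e i), B (e i)⟫_ℝ| ≤ ∑ i, ‖A (e i)‖ * ‖B (e i)‖ :=
    (Finset.abs_sum_le_sum_abs _ _).trans (Finset.sum_le_sum fun i _ => abs_real_inner_le_norm _ _)
  have h2 : (∑ i, ‖A (e i)‖ * ‖B (e i)‖) ^ 2 ≤ (∑ i, ‖A (e i)‖ ^ 2) * (∑ i, ‖B (e i)‖ ^ 2) :=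
    Finset.sum_mul_sq_le_sq_mul_sq _ _ _
  have hA : frobeniusNormSq A = ∑ i, ‖A (e i)‖ ^ 2 := frobeniusNormSq_eq_sum e A
  have hB : frobeniusNormSq B = ∑ i, ‖B (e i)‖ ^ 2 := frobeniusNormSq_eq_sum e B
  rw [hA, hB, ← Real.sqrt_mul (Finset.sum_nonneg fun i _ => sq_nonneg _)]
  refine h1.trans ?_
  have h0 : 0 ≤ ∑ i, ‖A (e i)‖ * ‖B (e i)‖ := Finset.sum_nonneg fun i _ => mul_nonneg (norm_nonneg _) (norm_nonneg _)
  rw [← Real.sqrt_sq h0]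
  exact Real.sqrt_le_sqrt h2

/-- **`|c₁(φ)| ≤ √W(v)·√W(φ)`.** [folklore] -/
theorem abs_C1_le (hv : ContDiff ℝ ∞ v) (h2 : ∫⁻ x, ‖iteratedFDeriv ℝ 2 v x‖ₑ ^ 2 < ⊤) (hφ : ContDiff ℝ ∞ φ)
    (hφc : HasCompactSupport φ) : |C1 v φ| ≤ Real.sqrt (Wpa v) * Real.sqrt (Wpa φ) := by
  have iW : Integrable (fun x => frobeniusNormSq (fderiv ℝ (curl v) x)) :=
    (integrable_frobeniusNormSq_fderiv_curl (hv.of_le (by norm_cast)) h2).1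
  have iWφ : Integrable (fun x => frobeniusNormSq (fderiv ℝ (curl φ) x)) := (integrable_palinstrophy_coeffs hφ hφ hφc).2
  have hω1 : ContDiff ℝ 1 (curl v) := contDiff_curl (n := 1) (hv.of_le (by norm_cast))
  have hψ1 : ContDiff ℝ 1 (curl φ) := contDiff_curl (n := 1) (hφ.of_le (by norm_cast))
  have cDω : Continuous (fderiv ℝ (curl v)) := hω1.continuous_fderiv one_ne_zero
  have cDψ : Continuous (fderiv ℝ (curl φ)) := hψ1.continuous_fderiv one_ne_zero
  set G : E3 → ℝ := fun x => |∑ i, ⟪fderiv ℝ (curl v) x (EuclideanSpace.basisFun (Fin 3) ℝ i),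
    fderiv ℝ (curl φ) x (EuclideanSpace.basisFun (Fin 3) ℝ i)⟫_ℝ| with hG
  have hGm : AEStronglyMeasurable G volume := by
    refine (continuous_abs.comp (continuous_finsetSum _ fun i _ => ?_)).aestronglyMeasurable
    exact (cDω.clm_apply continuous_const).inner (cDψ.clm_apply continuous_const)
  have hGle : ∀ᵐ x ∂(volume : Measure E3), G x ^ 2 ≤
      frobeniusNormSq (fderiv ℝ (curl v) x) * frobeniusNormSq (fderiv ℝ (curl φ) x) := by
    refine Eventually.of_forall fun x => ?_
    have h := abs_sum_inner_apply_le (fderiv ℝ (curl v) x) (fderiv ℝ (curl φ) x)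
    have h0 : 0 ≤ G x := abs_nonneg _
    calc G x ^ 2 ≤ (Real.sqrt (frobeniusNormSq (fderiv ℝ (curl v) x)) *
          Real.sqrt (frobeniusNormSq (fderiv ℝ (curl φ) x))) ^ 2 := pow_le_pow_left₀ h0 h 2
      _ = frobeniusNormSq (fderiv ℝ (curl v) x) * frobeniusNormSq (fderiv ℝ (curl φ) x) := by
          rw [mul_pow, Real.sq_sqrt (frobeniusNormSq_nonneg _), Real.sq_sqrt (frobeniusNormSq_nonneg _)]
  have h := Literature.Analysis.FluidPDE.integral_le_sqrt_integral_mul_integral (μ := (volume : Measure E3))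
    (G := G) (Eventually.of_forall fun x => abs_nonneg _)
    (Eventually.of_forall fun x => frobeniusNormSq_nonneg _) (Eventually.of_forall fun x => frobeniusNormSq_nonneg _)
    hGle hGm iW iWφ
  rw [Real.sqrt_mul (integral_nonneg fun x => frobeniusNormSq_nonneg _)] at h
  calc |C1 v φ| ≤ ∫ x, G x := by simp only [C1, hG]; exact abs_integral_le_integral_abs
    _ ≤ _ := h

/-! ## 3. The stretching coefficients `J₁(v;φ)`, `J₁(φ;v)`, `J(φ)` -/

/-- One mixed stretching term: `|∫⟪curl a, Db curl c⟫| ≤ L_b·√Z(a)·√Z(c)` (`‖Db‖ ≤ L_b`). [folklore] -/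
theorem abs_integral_stretch_le {a b c : E3 → E3} {Lb : ℝ} (ha : ContDiff ℝ ∞ a)
    (hc : ContDiff ℝ ∞ c) (hLb : ∀ x, ‖fderiv ℝ b x‖ ≤ Lb) (ha2 : ∫⁻ x, ‖curl a x‖ₑ ^ 2 < ⊤)
    (hc2 : ∫⁻ x, ‖curl c x‖ₑ ^ 2 < ⊤) :
    |∫ x, ⟪curl a x, fderiv ℝ b x (curl c x)⟫_ℝ| ≤ Lb * Real.sqrt (Zen a) * Real.sqrt (Zen c) :=
  abs_integral_inner_clm_le (continuous_curl (ha.of_le (by norm_cast))) (continuous_curl (hc.of_le (by norm_cast)))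
    hLb ha2 hc2

/-- **`|J₁(v;φ)| ≤ 2L_v·√Z(v)·√Z(φ) + L_φ·Z(v)`.** [folklore] -/
theorem abs_J1_le {Lv Lφ : ℝ} (hv : ContDiff ℝ ∞ v) (hLv : ∀ x, ‖fderiv ℝ v x‖ ≤ Lv)
    (h1 : ∫⁻ x, ‖iteratedFDeriv ℝ 1 v x‖ₑ ^ 2 < ⊤) (hφ : ContDiff ℝ ∞ φ) (hφc : HasCompactSupport φ)
    (hLφ : ∀ x, ‖fderiv ℝ φ x‖ ≤ Lφ) :
    |J1 v φ| ≤ 2 * Lv * Real.sqrt (Zen v) * Real.sqrt (Zen φ) + Lφ * Zen v := by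
  have hZ0 : 0 ≤ Zen v := integral_nonneg fun x => sq_nonneg _
  have l2ω := lintegral_enorm_curl_sq_lt_top hv h1
  have l2ψ := lintegral_enorm_curl_sq_lt_top_of_hasCompactSupport hφ hφc
  obtain ⟨i1, -, -⟩ := integrable_stretching_coeffs hv hφ hφc
  have cω : Continuous (curl v) := continuous_curl (hv.of_le (by norm_cast))
  have cψ : Continuous (curl φ) := continuous_curl (hφ.of_le (by norm_cast))
  have cDv : Continuous (fderiv ℝ v) := hv.continuous_fderiv (by simp)
  have cDφ : Continuous (fderiv ℝ φ) := hφ.continuous_fderiv (by simp)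
  have iA : Integrable (fun x => ⟪curl φ x, fderiv ℝ v x (curl v x)⟫_ℝ) :=
    integrable_of_norm_le_const_mul_mul Lv (cψ.inner (cDv.clm_apply cω)) cψ cω l2ψ l2ω fun x => by
      calc ‖⟪curl φ x, fderiv ℝ v x (curl v x)⟫_ℝ‖ ≤ ‖curl φ x‖ * ‖fderiv ℝ v x (curl v x)‖ := norm_inner_le_norm _ _
        _ ≤ ‖curl φ x‖ * (Lv * ‖curl v x‖) :=
            mul_le_mul_of_nonneg_left ((fderiv ℝ v x).le_of_opNorm_le (hLv x) _) (norm_nonneg _)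
        _ = Lv * ‖curl φ x‖ * ‖curl v x‖ := by ring
  have iB : Integrable (fun x => ⟪curl v x, fderiv ℝ φ x (curl v x)⟫_ℝ) :=
    integrable_of_norm_le_const_mul_mul Lφ (cω.inner (cDφ.clm_apply cω)) cω cω l2ω l2ω fun x => by
      calc ‖⟪curl v x, fderiv ℝ φ x (curl v x)⟫_ℝ‖ ≤ ‖curl v x‖ * ‖fderiv ℝ φ x (curl v x)‖ := norm_inner_le_norm _ _
        _ ≤ ‖curl v x‖ * (Lφ * ‖curl v x‖) :=
            mul_le_mul_of_nonneg_left ((fderiv ℝ φ x).le_of_opNorm_le (hLφ x) _) (norm_nonneg _)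
        _ = Lφ * ‖curl v x‖ * ‖curl v x‖ := by ring
  have iAB : Integrable (fun x => ⟪curl φ x, fderiv ℝ v x (curl v x)⟫_ℝ + ⟪curl v x, fderiv ℝ φ x (curl v x)⟫_ℝ) :=
    iA.add iB
  have hsplit : J1 v φ = (∫ x, ⟪curl φ x, fderiv ℝ v x (curl v x)⟫_ℝ) + (∫ x, ⟪curl v x, fderiv ℝ φ x (curl v x)⟫_ℝ)
      + ∫ x, ⟪curl v x, fderiv ℝ v x (curl φ x)⟫_ℝ := by
    have iC : Integrable (fun x => ⟪curl v x, fderiv ℝ v x (curl φ x)⟫_ℝ) := by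
      refine (i1.sub iAB).congr (Eventually.of_forall fun x => ?_)
      simp only [Pi.sub_apply]; ring
    rw [← integral_add iA iB, ← integral_add iAB iC]
    simp only [J1]
  have e1 := abs_integral_stretch_le hφ hv hLv l2ψ l2ω
  have e2 := abs_integral_stretch_le hv hv hLφ l2ω l2ω
  have e3 := abs_integral_stretch_le hv hφ hLv l2ω l2ψ
  rw [hsplit]
  have hZZ : Real.sqrt (Zen v) * Real.sqrt (Zen v) = Zen v := Real.mul_self_sqrt hZ0
  calc |(∫ x, ⟪curl φ x, fderiv ℝ v x (curl v x)⟫_ℝ) + (∫ x, ⟪curl v x, fderiv ℝ φ x (curl v x)⟫_ℝ)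
        + ∫ x, ⟪curl v x, fderiv ℝ v x (curl φ x)⟫_ℝ|
      ≤ |(∫ x, ⟪curl φ x, fderiv ℝ v x (curl v x)⟫_ℝ) + (∫ x, ⟪curl v x, fderiv ℝ φ x (curl v x)⟫_ℝ)|
        + |∫ x, ⟪curl v x, fderiv ℝ v x (curl φ x)⟫_ℝ| := abs_add_le _ _
    _ ≤ |∫ x, ⟪curl φ x, fderiv ℝ v x (curl v x)⟫_ℝ| + |∫ x, ⟪curl v x, fderiv ℝ φ x (curl v x)⟫_ℝ|
        + |∫ x, ⟪curl v x, fderiv ℝ v x (curl φ x)⟫_ℝ| := by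
        linarith [abs_add_le (∫ x, ⟪curl φ x, fderiv ℝ v x (curl v x)⟫_ℝ) (∫ x, ⟪curl v x, fderiv ℝ φ x (curl v x)⟫_ℝ)]
    _ ≤ Lv * Real.sqrt (Zen φ) * Real.sqrt (Zen v) + Lφ * Real.sqrt (Zen v) * Real.sqrt (Zen v)
        + Lv * Real.sqrt (Zen v) * Real.sqrt (Zen φ) := by linarith
    _ = 2 * Lv * Real.sqrt (Zen v) * Real.sqrt (Zen φ) + Lφ * Zen v := by rw [mul_assoc Lφ, hZZ]; ring

/-- **`|J₁(φ;v)| ≤ 2L_φ·√Z(v)·√Z(φ) + L_v·Z(φ)`** (the coefficient `J₂` of the expansion). [folklore] -/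
theorem abs_J1_swap_le {Lv Lφ : ℝ} (hv : ContDiff ℝ ∞ v) (hLv : ∀ x, ‖fderiv ℝ v x‖ ≤ Lv)
    (h1 : ∫⁻ x, ‖iteratedFDeriv ℝ 1 v x‖ₑ ^ 2 < ⊤) (hφ : ContDiff ℝ ∞ φ) (hφc : HasCompactSupport φ)
    (hLφ : ∀ x, ‖fderiv ℝ φ x‖ ≤ Lφ) :
    |J1 φ v| ≤ 2 * Lφ * Real.sqrt (Zen v) * Real.sqrt (Zen φ) + Lv * Zen φ := by
  have hZφ0 : 0 ≤ Zen φ := integral_nonneg fun x => sq_nonneg _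
  have l2ω := lintegral_enorm_curl_sq_lt_top hv h1
  have l2ψ := lintegral_enorm_curl_sq_lt_top_of_hasCompactSupport hφ hφc
  obtain ⟨-, i2, -⟩ := integrable_stretching_coeffs hv hφ hφc
  have cω : Continuous (curl v) := continuous_curl (hv.of_le (by norm_cast))
  have cψ : Continuous (curl φ) := continuous_curl (hφ.of_le (by norm_cast))
  have cDv : Continuous (fderiv ℝ v) := hv.continuous_fderiv (by simp)
  have cDφ : Continuous (fderiv ℝ φ) := hφ.continuous_fderiv (by simp)
  have iA : Integrable (fun x => ⟪curl φ x, fderiv ℝ φ x (curl v x)⟫_ℝ) :=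
    integrable_of_norm_le_const_mul_mul Lφ (cψ.inner (cDφ.clm_apply cω)) cψ cω l2ψ l2ω fun x => by
      calc ‖⟪curl φ x, fderiv ℝ φ x (curl v x)⟫_ℝ‖ ≤ ‖curl φ x‖ * ‖fderiv ℝ φ x (curl v x)‖ := norm_inner_le_norm _ _
        _ ≤ ‖curl φ x‖ * (Lφ * ‖curl v x‖) :=
            mul_le_mul_of_nonneg_left ((fderiv ℝ φ x).le_of_opNorm_le (hLφ x) _) (norm_nonneg _)
        _ = Lφ * ‖curl φ x‖ * ‖curl v x‖ := by ring
  have iB : Integrable (fun x => ⟪curl φ x, fderiv ℝ v x (curl φ x)⟫_ℝ) :=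
    integrable_of_norm_le_const_mul_mul Lv (cψ.inner (cDv.clm_apply cψ)) cψ cψ l2ψ l2ψ fun x => by
      calc ‖⟪curl φ x, fderiv ℝ v x (curl φ x)⟫_ℝ‖ ≤ ‖curl φ x‖ * ‖fderiv ℝ v x (curl φ x)‖ := norm_inner_le_norm _ _
        _ ≤ ‖curl φ x‖ * (Lv * ‖curl φ x‖) :=
            mul_le_mul_of_nonneg_left ((fderiv ℝ v x).le_of_opNorm_le (hLv x) _) (norm_nonneg _)
        _ = Lv * ‖curl φ x‖ * ‖curl φ x‖ := by ring
  have iAB : Integrable (fun x => ⟪curl φ x, fderiv ℝ φ x (curl v x)⟫_ℝ + ⟪curl φ x, fderiv ℝ v x (curl φ x)⟫_ℝ) :=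
    iA.add iB
  have hsplit : J1 φ v = (∫ x, ⟪curl φ x, fderiv ℝ φ x (curl v x)⟫_ℝ) + (∫ x, ⟪curl φ x, fderiv ℝ v x (curl φ x)⟫_ℝ)
      + ∫ x, ⟪curl v x, fderiv ℝ φ x (curl φ x)⟫_ℝ := by
    have iC : Integrable (fun x => ⟪curl v x, fderiv ℝ φ x (curl φ x)⟫_ℝ) := by
      refine (i2.sub iAB).congr (Eventually.of_forall fun x => ?_)
      simp only [Pi.sub_apply]; ring
    rw [← integral_add iA iB, ← integral_add iAB iC]
    simp only [J1]
    refine integral_congr_ae (Eventually.of_forall fun x => ?_)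
    ring
  have e1 := abs_integral_stretch_le hφ hv hLφ l2ψ l2ω
  have e2 := abs_integral_stretch_le hφ hφ hLv l2ψ l2ψ
  have e3 := abs_integral_stretch_le hv hφ hLφ l2ω l2ψ
  rw [hsplit]
  have hZZ : Real.sqrt (Zen φ) * Real.sqrt (Zen φ) = Zen φ := Real.mul_self_sqrt hZφ0
  calc |(∫ x, ⟪curl φ x, fderiv ℝ φ x (curl v x)⟫_ℝ) + (∫ x, ⟪curl φ x, fderiv ℝ v x (curl φ x)⟫_ℝ)
        + ∫ x, ⟪curl v x, fderiv ℝ φ x (curl φ x)⟫_ℝ|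
      ≤ |(∫ x, ⟪curl φ x, fderiv ℝ φ x (curl v x)⟫_ℝ) + (∫ x, ⟪curl φ x, fderiv ℝ v x (curl φ x)⟫_ℝ)|
        + |∫ x, ⟪curl v x, fderiv ℝ φ x (curl φ x)⟫_ℝ| := abs_add_le _ _
    _ ≤ |∫ x, ⟪curl φ x, fderiv ℝ φ x (curl v x)⟫_ℝ| + |∫ x, ⟪curl φ x, fderiv ℝ v x (curl φ x)⟫_ℝ|
        + |∫ x, ⟪curl v x, fderiv ℝ φ x (curl φ x)⟫_ℝ| := by
        linarith [abs_add_le (∫ x, ⟪curl φ x, fderiv ℝ φ x (curl v x)⟫_ℝ) (∫ x, ⟪curl φ x, fderiv ℝ v x (curl φ x)⟫_ℝ)]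
    _ ≤ Lφ * Real.sqrt (Zen φ) * Real.sqrt (Zen v) + Lv * Real.sqrt (Zen φ) * Real.sqrt (Zen φ)
        + Lφ * Real.sqrt (Zen v) * Real.sqrt (Zen φ) := by linarith
    _ = 2 * Lφ * Real.sqrt (Zen v) * Real.sqrt (Zen φ) + Lv * Zen φ := by rw [mul_assoc Lv, hZZ]; ring

/-- **`|J(φ)| ≤ L_φ·Z(φ)`** for `φ ∈ C_c^∞` with `‖Dφ‖ ≤ L_φ`. [folklore] -/
theorem abs_Jst_le {Lφ : ℝ} (hφ : ContDiff ℝ ∞ φ) (hφc : HasCompactSupport φ) (hLφ : ∀ x, ‖fderiv ℝ φ x‖ ≤ Lφ) :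
    |Jst φ| ≤ Lφ * Zen φ := by
  have hZφ0 : 0 ≤ Zen φ := integral_nonneg fun x => sq_nonneg _
  have l2ψ := lintegral_enorm_curl_sq_lt_top_of_hasCompactSupport hφ hφc
  have h := abs_integral_stretch_le hφ hφ hLφ l2ψ l2ψ
  simp only [Jst]
  rw [mul_assoc, Real.mul_self_sqrt hZφ0] at h
  exact h

end DepletionLadder.KStar.BangBang

end Summit.NavierStokesRegularity.NavierStokesRegularity.Theorems

end
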